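import Summits.Parity.BatemanHorn.Theorems.SoloInformedProgressionSystem
import Literature.NumberTheory.LFunctions.BatemanHornSystemEulerProduct

/-!
# SoloInformedAffineSubstitution — a Bateman–Horn system restricted to a residue class (general `k`)

Solo unit `solo-Parity-informed` (ideation tier, informed mode), session 148; `PLAN.md` §113, CLAIMS C302.

For a system `f = (f_i)_{i ∈ ι}` of integer polynomials, a modulus `W ≥ 1` and a residue `b`, the
**affine substitution** `n ↦ Wn + b` gives the system `f^{(W,b)} := (f_i(WX + b))_{i ∈ ι}`.  This file
is the algebra and the counting of that substitution for an arbitrary (finite) index type `ι`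
(the case `ι = Fin 1` is `SoloInformedProgressionSystem`):

* root counts (`F = ∏ f_i`): `ω_{f^{(W,b)}}(p) = ω_f(p)` for `p ∤ W`
  (`polyRootCountMod_affine_of_not_dvd`), `= 0` for `p ∣ W`, `p ∤ F(b)`
  (`polyRootCountMod_affine_of_dvd`) and `= p` for `p ∣ W`, `p ∣ F(b)`
  (`polyRootCountMod_affine_of_dvd_of_dvd`);
* if `f` is a Bateman–Horn system and `b` is **admissible** (`p ∤ F(b)` for every prime `p ∣ W`)
  then `f^{(W,b)}` is a Bateman–Horn system (`isBatemanHornSystem_affine`; the pairwise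
  non-association transfers because `g ↦ g(WX + b)` is injective, `comp_C_mul_X_add_C_injective`)
  with constant `C(f^{(W,b)}) = C(f) · ∏_{p ∣ W} (1 - ω_f(p)/p)⁻¹` (`batemanHornConst_affine`);
* the prime-value count of `f` fibres over the classes mod `W`:
  `#{n ≤ x : n ≡ b (W), all f_i(n) prime} = π_{f^{(W,b)}}(⌊(x-b)/W⌋)`
  (`card_filter_modEq_eq_polyPrimeCount_affine`) and `π_f(x) = ∑_{b < W} π_{f^{(W,b)}}(⌊(x-b)/W⌋)`
  for `x + 1 ≥ W` (`polyPrimeCount_eq_sum_affine`);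
* a non-admissible class carries at most `∑ deg f_i` prime values (`polyPrimeCount_affine_le_of_dvd`:
  some `f_i(Wm + b)` must *equal* the prime `p`; the value bound is `card_filter_eval_eq_le` of
  `SoloInformedQuadraticPrimeCount`).

The asymptotic consequences (Bateman–Horn in progressions, the single-prime fibration and the
`W`-trick reduction of the conjecture) are in `SoloInformedWTrick`.
-/

namespace Summit.Parity.BatemanHorn.Theorems

open Finset Filter Polynomial
open scoped Topology
open Literature.NumberTheory.Sieve (polyRootCountMod polyPrimeCount IsBatemanHornSystem
  batemanHornPartial HasBatemanHornConst batemanHornConst polyRootCountMod_single)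
open Literature.NumberTheory.LFunctions (polyRootCountMod_prod_single)

variable {ι : Type*} [Fintype ι]

/-! ### Evaluation -/

/-- `g(WX + b)(m) = g(Wm + b)`. -/
theorem eval_comp_C_mul_X_add_C (g : ℤ[X]) (W b m : ℤ) :
    (g.comp (C W * X + C b)).eval m = g.eval (W * m + b) := by
  simp [eval_comp]

/-- `∏_i f_i(WX + b)(m) = F(Wm + b)` with `F = ∏_i f_i`. -/
theorem prod_eval_comp_C_mul_X_add_C (f : ι → ℤ[X]) (W b m : ℤ) :
    ∏ i, ((f i).comp (C W * X + C b)).eval m = (∏ i, f i).eval (W * m + b) := by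
  rw [eval_prod]
  simp [eval_comp]

/-- `F(Wm + b) ≡ F(b) (mod p)` for `p ∣ W`: divisibility by `p` of `∏_i f_i(WX + b)(m)` is decided
by `F(b)`. -/
theorem dvd_prod_eval_comp_iff (f : ι → ℤ[X]) {W : ℕ} (b m : ℤ) {p : ℕ} (hpW : p ∣ W) :
    (p : ℤ) ∣ ∏ i, ((f i).comp (C (W : ℤ) * X + C b)).eval m ↔ (p : ℤ) ∣ ∏ i, (f i).eval b := by
  rw [prod_eval_comp_C_mul_X_add_C, ← eval_prod]
  have hsub := sub_dvd_eval_sub ((W : ℤ) * m + b) b (∏ i, f i)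
  rw [add_sub_cancel_right] at hsub
  have h : (p : ℤ) ∣ (∏ i, f i).eval ((W : ℤ) * m + b) - (∏ i, f i).eval b :=
    ((Int.natCast_dvd_natCast.mpr hpW).mul_right _).trans hsub
  constructor
  · intro hm
    exact (dvd_sub_right hm).mp h
  · intro hb
    have := dvd_add h hb
    rwa [sub_add_cancel] at this

/-! ### Root counts -/

/-- For a prime `p ∤ W`, `f^{(W,b)}` and `f` have the same number of roots of `F` mod `p`. -/
theorem polyRootCountMod_affine_of_not_dvd (f : ι → ℤ[X]) {W : ℕ} (b : ℤ) {p : ℕ} (hp : p.Prime)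
    (hpW : ¬ p ∣ W) :
    polyRootCountMod (fun i => (f i).comp (C (W : ℤ) * X + C b)) p = polyRootCountMod f p := by
  have h1 := polyRootCountMod_prod_single (fun i => (f i).comp (C (W : ℤ) * X + C b)) p
  rw [← Polynomial.prod_comp] at h1
  rw [← h1, polyRootCountMod_comp_C_mul_X_add_C_of_not_dvd _ b hp hpW, polyRootCountMod_prod_single]

/-- For a prime `p ∣ W` and an admissible residue (`p ∤ F(b)`), `f^{(W,b)}` has no roots mod `p`. -/
theorem polyRootCountMod_affine_of_dvd (f : ι → ℤ[X]) {W : ℕ} {b : ℤ} {p : ℕ} (hpW : p ∣ W)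
    (hb : ¬ (p : ℤ) ∣ ∏ i, (f i).eval b) :
    polyRootCountMod (fun i => (f i).comp (C (W : ℤ) * X + C b)) p = 0 := by
  unfold polyRootCountMod
  rw [card_eq_zero, filter_eq_empty_iff]
  intro n _ hn
  exact hb ((dvd_prod_eval_comp_iff f b (n : ℤ) hpW).mp hn)

/-- For `p ∣ W` and `p ∣ F(b)`, every residue is a root of `∏_i f_i(WX + b)` mod `p`. -/
theorem polyRootCountMod_affine_of_dvd_of_dvd (f : ι → ℤ[X]) {W : ℕ} {b : ℤ} {p : ℕ} (hpW : p ∣ W)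
    (hb : (p : ℤ) ∣ ∏ i, (f i).eval b) :
    polyRootCountMod (fun i => (f i).comp (C (W : ℤ) * X + C b)) p = p := by
  have h : ∀ n ∈ range p,
      (p : ℤ) ∣ ∏ i, ((fun i => (f i).comp (C (W : ℤ) * X + C b)) i).eval (n : ℤ) :=
    fun n _ => (dvd_prod_eval_comp_iff f b (n : ℤ) hpW).mpr hb
  unfold polyRootCountMod
  rw [filter_true_of_mem h, card_range]

/-! ### Injectivity of the substitution and non-association -/

/-- `g ↦ g(WX + b)` is injective on `ℤ[X]` for `W ≠ 0` (over `ℚ` it is an algebra automorphism). -/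
theorem comp_C_mul_X_add_C_injective {W : ℤ} (hW : W ≠ 0) (b : ℤ) :
    Function.Injective fun g : ℤ[X] => g.comp (C W * X + C b) := by
  intro g h hgh
  apply map_injective (Int.castRingHom ℚ) Int.cast_injective
  haveI : Invertible (W : ℚ) := invertibleOfNonzero (by exact_mod_cast hW)
  apply (algEquivCMulXAddC (W : ℚ) (b : ℚ)).injective
  rw [algEquivCMulXAddC_apply, algEquivCMulXAddC_apply, ← comp_eq_aeval, ← comp_eq_aeval]
  have hmap : ∀ g : ℤ[X], (g.map (Int.castRingHom ℚ)).comp (C (W : ℚ) * X + C (b : ℚ))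
      = (g.comp (C W * X + C b)).map (Int.castRingHom ℚ) := by
    intro g
    rw [Polynomial.map_comp]
    simp
  rw [hmap, hmap]
  exact congrArg (Polynomial.map (Int.castRingHom ℚ)) hgh

/-- If `g(WX + b)` and `h(WX + b)` are associated (`W ≠ 0`) then so are `g` and `h`. -/
theorem associated_of_associated_comp_C_mul_X_add_C {g h : ℤ[X]} {W : ℤ} (hW : W ≠ 0) (b : ℤ)
    (hgh : Associated (g.comp (C W * X + C b)) (h.comp (C W * X + C b))) : Associated g h := by
  obtain ⟨u, hu⟩ := hgh
  obtain ⟨r, hr, hru⟩ := Polynomial.isUnit_iff.mp u.isUnit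
  have hCr : IsUnit (C r) := hr.map C
  refine ⟨hCr.unit, ?_⟩
  rw [IsUnit.unit_spec]
  apply comp_C_mul_X_add_C_injective hW b
  show (g * C r).comp (C W * X + C b) = h.comp (C W * X + C b)
  rw [mul_comp, C_comp, hru, hu]

/-! ### The Bateman–Horn system `f^{(W,b)}` -/

/-- **`f^{(W,b)}` is a Bateman–Horn system** when `f` is one, `W ≠ 0`, and `b` is admissible
(`p ∤ F(b)` for every prime `p ∣ W`). -/
theorem isBatemanHornSystem_affine {f : ι → ℤ[X]} (hf : IsBatemanHornSystem f) {W : ℕ}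
    (hW : W ≠ 0) {b : ℤ} (hb : ∀ p : ℕ, p.Prime → p ∣ W → ¬ (p : ℤ) ∣ ∏ i, (f i).eval b) :
    IsBatemanHornSystem (fun i => (f i).comp (C (W : ℤ) * X + C b)) := by
  have hWz : (W : ℤ) ≠ 0 := by exact_mod_cast hW
  have hbi : ∀ i, ∀ p : ℕ, p.Prime → p ∣ W → ¬ (p : ℤ) ∣ (f i).eval b := fun i p hp hpW h =>
    hb p hp hpW (h.trans (dvd_prod_of_mem (fun i => (f i).eval b) (mem_univ i)))
  refine ⟨fun i => ?_, fun i => ?_, fun i j hij hass => ?_, fun p hp => ?_⟩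
  · exact irreducible_comp_C_mul_X_add_C (hf.irreducible i) (hf.natDegree_pos i).ne' hW (hbi i)
  · show 0 < ((f i).comp (C (W : ℤ) * X + C b)).leadingCoeff
    rw [leadingCoeff_comp_C_mul_X_add_C hWz]
    exact mul_pos (hf.leadingCoeff_pos i) (pow_pos (by exact_mod_cast Nat.pos_of_ne_zero hW) _)
  · exact hf.pairwise_not_associated hij (associated_of_associated_comp_C_mul_X_add_C hWz b hass)
  · by_cases hpW : p ∣ W
    · rw [polyRootCountMod_affine_of_dvd f hpW (hb p hp hpW)]
      exact hp.pos
    · rw [polyRootCountMod_affine_of_not_dvd f b hp hpW]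
      exact hf.hasNoFixedPrimeDivisor p hp

/-- `deg f_i(WX + b) = deg f_i`, as a product over the system (cast to `ℝ`). -/
theorem prod_natDegree_affine (f : ι → ℤ[X]) {W : ℕ} (hW : W ≠ 0) (b : ℤ) :
    ∏ i, ((((f i).comp (C (W : ℤ) * X + C b)).natDegree : ℕ) : ℝ) = ∏ i, ((f i).natDegree : ℝ) := by
  refine prod_congr rfl fun i _ => ?_
  rw [natDegree_comp_C_mul_X_add_C (show (W : ℤ) ≠ 0 by exact_mod_cast hW)]

/-! ### The constant -/

/-- The partial products of the constant of `f^{(W,b)}` for `x ≥ W`: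
`∏_{p ≤ x}^{(f^{(W,b)})} = ∏_{p ≤ x}^{(f)} · ∏_{p ∣ W} (1 - ω_f(p)/p)⁻¹`. -/
theorem batemanHornPartial_affine {f : ι → ℤ[X]} (hf : IsBatemanHornSystem f) {W : ℕ} (hW : W ≠ 0)
    {b : ℤ} (hb : ∀ p : ℕ, p.Prime → p ∣ W → ¬ (p : ℤ) ∣ ∏ i, (f i).eval b) {x : ℕ} (hx : W ≤ x) :
    batemanHornPartial (fun i => (f i).comp (C (W : ℤ) * X + C b)) x
      = batemanHornPartial f x * ∏ q ∈ W.primeFactors, (1 - (polyRootCountMod f q : ℝ) / q)⁻¹ := by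
  classical
  have hρ : ∀ p ∈ Nat.primesLE x, (polyRootCountMod (fun i => (f i).comp (C (W : ℤ) * X + C b)) p : ℝ)
      = if p ∈ W.primeFactors then 0 else (polyRootCountMod f p : ℝ) := by
    intro p hp
    have hpp : p.Prime := (Nat.mem_primesBelow.mp hp).2
    split_ifs with hpS
    · rw [polyRootCountMod_affine_of_dvd f (Nat.mem_primeFactors.mp hpS).2.1
        (hb p hpp (Nat.mem_primeFactors.mp hpS).2.1), Nat.cast_zero]
    · rw [polyRootCountMod_affine_of_not_dvd f b hpp
        (fun h => hpS (Nat.mem_primeFactors.mpr ⟨hpp, h, hW⟩))]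
  have hne : ∀ q ∈ W.primeFactors, (1 - (polyRootCountMod f q : ℝ) / q) ≠ 0 := by
    intro q hq
    have hqp := (Nat.mem_primeFactors.mp hq).1
    have hlt : (polyRootCountMod f q : ℝ) < q := by
      exact_mod_cast hf.hasNoFixedPrimeDivisor q hqp
    have hq0 : (0 : ℝ) < q := by exact_mod_cast hqp.pos
    rw [sub_ne_zero, ne_comm, Ne, div_eq_one_iff_eq hq0.ne']
    exact hlt.ne
  have hsub : W.primeFactors ⊆ Nat.primesLE x := fun q hq =>
    Nat.mem_primesBelow.mpr ⟨Nat.lt_succ_of_le ((Nat.le_of_dvd (Nat.pos_of_ne_zero hW)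
      (Nat.mem_primeFactors.mp hq).2.1).trans hx), (Nat.mem_primeFactors.mp hq).1⟩
  unfold batemanHornPartial
  rw [← inter_eq_right.mpr hsub, ← prod_ite_mem, ← prod_mul_distrib]
  refine prod_congr rfl fun p hp => ?_
  rw [hρ p hp]
  split_ifs with hpS
  · rw [zero_div, sub_zero, mul_one, mul_assoc, mul_inv_cancel₀ (hne p hpS), mul_one]
  · rw [mul_one]

/-- **The Bateman–Horn constant of `f^{(W,b)}`** (`b` admissible):
`C(f^{(W,b)}) = C(f) · ∏_{p ∣ W} (1 - ω_f(p)/p)⁻¹`. -/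
theorem hasBatemanHornConst_affine {f : ι → ℤ[X]} (hf : IsBatemanHornSystem f) {W : ℕ} (hW : W ≠ 0)
    {b : ℤ} (hb : ∀ p : ℕ, p.Prime → p ∣ W → ¬ (p : ℤ) ∣ ∏ i, (f i).eval b) :
    HasBatemanHornConst (fun i => (f i).comp (C (W : ℤ) * X + C b))
      (batemanHornConst f * ∏ q ∈ W.primeFactors, (1 - (polyRootCountMod f q : ℝ) / q)⁻¹) := by
  have hC := (IsBatemanHornSystem.hasBatemanHornConst_holds hf).1
  unfold HasBatemanHornConst at hC ⊢
  have hev : ∀ᶠ x : ℕ in atTop, batemanHornPartial (fun i => (f i).comp (C (W : ℤ) * X + C b)) x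
      = batemanHornPartial f x * ∏ q ∈ W.primeFactors, (1 - (polyRootCountMod f q : ℝ) / q)⁻¹ := by
    filter_upwards [eventually_ge_atTop W] with x hx
    exact batemanHornPartial_affine hf hW hb hx
  rw [tendsto_congr' hev]
  exact hC.mul_const _

/-- The constant of `f^{(W,b)}` as a number:
`batemanHornConst f^{(W,b)} = C(f) ∏_{p ∣ W} (1 - ω_f(p)/p)⁻¹`. -/
theorem batemanHornConst_affine {f : ι → ℤ[X]} (hf : IsBatemanHornSystem f) {W : ℕ} (hW : W ≠ 0)
    {b : ℤ} (hb : ∀ p : ℕ, p.Prime → p ∣ W → ¬ (p : ℤ) ∣ ∏ i, (f i).eval b) :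
    batemanHornConst (fun i => (f i).comp (C (W : ℤ) * X + C b))
      = batemanHornConst f * ∏ q ∈ W.primeFactors, (1 - (polyRootCountMod f q : ℝ) / q)⁻¹ :=
  (hasBatemanHornConst_affine hf hW hb).batemanHornConst_eq

/-! ### Counting prime values class by class -/

/-- **The prime values of `f` in the class `b (mod W)` are the prime values of `f^{(W,b)}`:**
for `b < W`, `b ≤ x`, `#{n ≤ x : n ≡ b (mod W), f_i(n) prime ∀ i} = π_{f^{(W,b)}}(⌊(x - b)/W⌋)`
(`n = Wm + b`, `m ≤ (x - b)/W`). -/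
theorem card_filter_modEq_eq_polyPrimeCount_affine (f : ι → ℤ[X]) {W : ℕ} (hW : W ≠ 0) {b x : ℕ}
    (hbW : b < W) (hbx : b ≤ x) :
    #((range (x + 1)).filter fun n : ℕ =>
        n % W = b ∧ ∀ i, 0 < (f i).eval (n : ℤ) ∧ ((f i).eval (n : ℤ)).toNat.Prime)
      = polyPrimeCount (fun i => (f i).comp (C (W : ℤ) * X + C (b : ℤ))) ((x - b) / W) := by
  have hW0 : 0 < W := Nat.pos_of_ne_zero hW
  unfold polyPrimeCount
  symm
  refine card_bij (fun m _ => W * m + b) ?_ ?_ ?_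
  · intro m hm
    simp only [mem_filter, mem_range] at hm ⊢
    obtain ⟨hm, hP⟩ := hm
    refine ⟨?_, ?_, fun i => ?_⟩
    · have h1 : m * W ≤ x - b := (Nat.le_div_iff_mul_le hW0).mp (Nat.lt_succ_iff.mp hm)
      rw [mul_comm] at h1
      exact Nat.lt_succ_of_le ((Nat.le_sub_iff_add_le hbx).mp h1)
    · rw [Nat.mul_add_mod, Nat.mod_eq_of_lt hbW]
    · have h := hP i
      rwa [eval_comp_C_mul_X_add_C, show (W : ℤ) * (m : ℤ) + (b : ℤ) = ((W * m + b : ℕ) : ℤ) by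
        push_cast; ring] at h
  · intro m₁ _ m₂ _ h
    exact Nat.eq_of_mul_eq_mul_left hW0 (Nat.add_right_cancel h)
  · intro n hn
    simp only [mem_filter, mem_range] at hn
    obtain ⟨hnx, hnb, hP⟩ := hn
    have hdm : W * (n / W) + b = n := by
      have h := Nat.div_add_mod n W
      rwa [hnb] at h
    refine ⟨n / W, ?_, hdm⟩
    simp only [mem_filter, mem_range]
    refine ⟨?_, fun i => ?_⟩
    · refine Nat.lt_succ_of_le ((Nat.le_div_iff_mul_le hW0).mpr ?_)
      rw [mul_comm]
      omega
    · rw [eval_comp_C_mul_X_add_C, show (W : ℤ) * ((n / W : ℕ) : ℤ) + (b : ℤ) = (n : ℤ) by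
        exact_mod_cast hdm]
      exact hP i

/-- **Fibration of the prime-value count over the classes mod `W`:** for `W ≥ 1` and `x + 1 ≥ W`,
`π_f(x) = ∑_{b < W} π_{f^{(W,b)}}(⌊(x - b)/W⌋)`. -/
theorem polyPrimeCount_eq_sum_affine (f : ι → ℤ[X]) {W : ℕ} (hW : W ≠ 0) {x : ℕ} (hx : W ≤ x + 1) :
    polyPrimeCount f x = ∑ b ∈ range W,
      polyPrimeCount (fun i => (f i).comp (C (W : ℤ) * X + C (b : ℤ))) ((x - b) / W) := by
  classical
  have hW0 : 0 < W := Nat.pos_of_ne_zero hW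
  calc polyPrimeCount f x
      = ∑ b ∈ range W, #(((range (x + 1)).filter fun n : ℕ => ∀ i, 0 < (f i).eval (n : ℤ) ∧
          ((f i).eval (n : ℤ)).toNat.Prime).filter fun n : ℕ => n % W = b) :=
        card_eq_sum_card_fiberwise fun n _ => mem_coe.mpr (mem_range.mpr (Nat.mod_lt n hW0))
    _ = ∑ b ∈ range W,
          polyPrimeCount (fun i => (f i).comp (C (W : ℤ) * X + C (b : ℤ))) ((x - b) / W) := by
        refine sum_congr rfl fun b hb => ?_
        rw [mem_range] at hb
        rw [filter_filter, ← card_filter_modEq_eq_polyPrimeCount_affine f hW hb (by omega)]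
        congr 1
        exact filter_congr fun n _ => and_comm

/-! ### Non-admissible classes are negligible -/

/-- **A non-admissible class is negligible:** if `p ∣ W` and `p ∣ F(b)` then for every `m`,
`π_{f^{(W,b)}}(m) ≤ ∑_i deg f_i` — every `F(Wn + b)` is divisible by `p`, so if all the `f_i(Wn + b)`
are primes one of them *equals* `p`, which happens at most `deg f_i` times for each `i`. -/
theorem polyPrimeCount_affine_le_of_dvd {f : ι → ℤ[X]} (hf : IsBatemanHornSystem f) {W : ℕ}
    (hW : W ≠ 0) {b : ℤ} {p : ℕ} (hp : p.Prime) (hpW : p ∣ W) (hb : (p : ℤ) ∣ ∏ i, (f i).eval b)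
    (m : ℕ) :
    polyPrimeCount (fun i => (f i).comp (C (W : ℤ) * X + C b)) m ≤ ∑ i, (f i).natDegree := by
  classical
  have hpZ : Prime (p : ℤ) := Nat.prime_iff_prime_int.mp hp
  have hWz : (W : ℤ) ≠ 0 := by exact_mod_cast hW
  unfold polyPrimeCount
  have hsub : ((range (m + 1)).filter fun n : ℕ =>
        ∀ i, 0 < ((f i).comp (C (W : ℤ) * X + C b)).eval (n : ℤ) ∧
          (((f i).comp (C (W : ℤ) * X + C b)).eval (n : ℤ)).toNat.Prime)
      ⊆ (univ : Finset ι).biUnion fun i =>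
          (range (m + 1)).filter fun n : ℕ => ((f i).comp (C (W : ℤ) * X + C b)).eval (n : ℤ) = p := by
    intro n hn
    rw [mem_filter] at hn
    obtain ⟨hnm, hP⟩ := hn
    rw [mem_biUnion]
    have hdvd : (p : ℤ) ∣ ∏ i, ((f i).comp (C (W : ℤ) * X + C b)).eval (n : ℤ) :=
      (dvd_prod_eval_comp_iff f b (n : ℤ) hpW).mpr hb
    obtain ⟨i, -, hi⟩ := hpZ.exists_mem_finset_dvd hdvd
    refine ⟨i, mem_univ i, mem_filter.mpr ⟨hnm, ?_⟩⟩
    obtain ⟨hpos, hprime⟩ := hP i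
    have hv : ((((f i).comp (C (W : ℤ) * X + C b)).eval (n : ℤ)).toNat : ℤ)
        = ((f i).comp (C (W : ℤ) * X + C b)).eval (n : ℤ) := Int.toNat_of_nonneg hpos.le
    rw [← hv] at hi ⊢
    rw [(Nat.prime_dvd_prime_iff_eq hp hprime).mp (Int.natCast_dvd_natCast.mp hi)]
  refine (card_le_card hsub).trans (card_biUnion_le.trans (sum_le_sum fun i _ => ?_))
  have h := card_filter_eval_eq_le ((f i).comp (C (W : ℤ) * X + C b))
    (by rw [natDegree_comp_C_mul_X_add_C hWz]; exact hf.natDegree_pos i) (range (m + 1)) (p : ℤ)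
  rwa [natDegree_comp_C_mul_X_add_C hWz] at h

end Summit.Parity.BatemanHorn.Theorems
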